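import Mathlib
import HarnessLib
import Literature.Analysis.FluidPDE.VectorCalculus
import Summits.NavierStokesRegularity.NavierStokesRegularity.Theorems.UnthreadedDoorToroidalPotentialClosed

/-!
# Route `UnthreadedDoor` / `ThreadingFlux`, crux `PoloidalLiouville` (stmt-NavierStokesRegularity-1222), antidynamo v2 skeleton
# (sha16 `4ebf5683127b`), rung `stub_singleDegreeRung` (BC5): SMOOTH UNIT-SPHERE CURVES THROUGH TWO NEARBY DIRECTIONS (geometry for step S2(b))

Support file (seat leafhand-ns-unthreadeddoor-1 g0, cell decomp-ns), `--supports stmt-NavierStokesRegularity-1222 --as helper`; theorems only.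
The spherical-path coefficient brick (`…AntidynamoSpherePathCoefficient`, p795123) integrates along a GLOBALLY smooth unit curve
`γ : ℝ → S²`; this file supplies such curves: for unit vectors `θ₁ ≠ ±θ₂` the normalised chord
`γ(τ) = (θ₁ + τ(θ₂ − θ₁)) / ‖θ₁ + τ(θ₂ − θ₁)‖` is defined and `C^∞` on all of `ℝ` (the chord line misses the origin), has unit norm,
joins `θ₁ = γ 0` to `θ₂ = γ 1`, and stays within `2‖θ₂ − θ₁‖` of `θ₁` on `[0,1]`.

* `chord_ne_zero` — `θ₁ + τ(θ₂ − θ₁) ≠ 0` for all `τ` when `‖θ₁‖ = ‖θ₂‖ = 1`, `θ₂ ≠ −θ₁`.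
* ★ `exists_smooth_sphereCurve` — the packaged curve with the five properties.

HONEST LABEL: elementary geometry for the plan-only rung; nothing here bears on `PoloidalLiouville` (1222) or NS regularity. [folklore]
-/

noncomputable section

-- the summit and its single sub-problem share the name (CONVENTIONS §1)
set_option linter.dupNamespace false

open scoped Topology InnerProductSpace RealInnerProductSpace ContDiff
open Filter Set Function Metric
open Literature.Analysis.FluidPDE

namespace Summit.NavierStokesRegularity.NavierStokesRegularity.Theorems.PoloidalLiouville.Antidynamo

/-- The chord between two unit vectors that are not antipodal misses the origin — on the whole chord LINE. [folklore] -/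
theorem chord_ne_zero {θ₁ θ₂ : EuclideanSpace ℝ (Fin 3)} (h₁ : ‖θ₁‖ = 1) (h₂ : ‖θ₂‖ = 1) (hanti : θ₂ ≠ -θ₁) (τ : ℝ) :
    θ₁ + τ • (θ₂ - θ₁) ≠ 0 := by
  intro h0
  set a : ℝ := ⟪θ₁, θ₂⟫ with ha
  have e1 : ⟪θ₁, θ₁ + τ • (θ₂ - θ₁)⟫ = 0 := by rw [h0, inner_zero_right]
  have e2 : ⟪θ₂, θ₁ + τ • (θ₂ - θ₁)⟫ = 0 := by rw [h0, inner_zero_right]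
  have n1 : ⟪θ₁, θ₁⟫ = 1 := by rw [real_inner_self_eq_norm_sq, h₁, one_pow]
  have n2 : ⟪θ₂, θ₂⟫ = 1 := by rw [real_inner_self_eq_norm_sq, h₂, one_pow]
  have c21 : ⟪θ₂, θ₁⟫ = a := by rw [ha, real_inner_comm]
  simp only [inner_add_right, inner_smul_right, inner_sub_right, n1, n2, c21, ← ha] at e1 e2
  -- `(1 − τ) + τ a = 0` and `(1 − τ) a + τ = 0` force `a = −1`
  have hτ : τ * (a - 1) = -1 := by linarith
  have ha1 : a = -1 := by nlinarith [hτ, e1, e2]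
  -- `⟪θ₁, θ₂⟫ = −1` with unit vectors forces `θ₂ = −θ₁`
  have hsum : ‖θ₁ + θ₂‖ ^ 2 = 0 := by
    rw [norm_add_sq_real, h₁, h₂, ← ha, ha1]; ring
  have : θ₁ + θ₂ = 0 := by
    have := pow_eq_zero_iff (n := 2) (by norm_num) |>.1 hsum
    exact norm_eq_zero.1 this
  exact hanti (by rw [eq_neg_iff_add_eq_zero, add_comm]; exact this)

/-- ★ SMOOTH UNIT-SPHERE CURVE THROUGH TWO NEARBY DIRECTIONS.  For unit vectors `θ₁`, `θ₂` with `θ₂ ≠ −θ₁` there is a globally `C^∞`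
curve `γ : ℝ → ℝ³` with `‖γ τ‖ = 1` for all `τ`, `γ 0 = θ₁`, `γ 1 = θ₂`, and `‖γ τ − θ₁‖ ≤ 2 ‖θ₂ − θ₁‖` for `τ ∈ [0,1]` (the normalised
chord). [folklore] -/
theorem exists_smooth_sphereCurve {θ₁ θ₂ : EuclideanSpace ℝ (Fin 3)} (h₁ : ‖θ₁‖ = 1) (h₂ : ‖θ₂‖ = 1) (hanti : θ₂ ≠ -θ₁) :
    ∃ γ : ℝ → EuclideanSpace ℝ (Fin 3), ContDiff ℝ ∞ γ ∧ (∀ τ, ‖γ τ‖ = 1) ∧ γ 0 = θ₁ ∧ γ 1 = θ₂ ∧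
      ∀ τ ∈ Icc (0 : ℝ) 1, ‖γ τ - θ₁‖ ≤ 2 * ‖θ₂ - θ₁‖ := by
  set c : ℝ → EuclideanSpace ℝ (Fin 3) := fun τ => θ₁ + τ • (θ₂ - θ₁) with hc
  have hc0 : ∀ τ, c τ ≠ 0 := fun τ => chord_ne_zero h₁ h₂ hanti τ
  have hcs : ContDiff ℝ ∞ c := contDiff_const.add (contDiff_id.smul contDiff_const)
  refine ⟨fun τ => (1 / ‖c τ‖) • c τ, ?_, ?_, ?_, ?_, ?_⟩
  · rw [contDiff_iff_contDiffAt]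
    intro τ
    exact (contDiffAt_radialProj 1 (hc0 τ)).comp τ hcs.contDiffAt
  · intro τ
    rw [norm_radialProj (hc0 τ), abs_one]
  · have : c 0 = θ₁ := by simp [hc]
    simp only [this, h₁, div_one, one_smul]
  · have : c 1 = θ₂ := by simp [hc]
    simp only [this, h₂, div_one, one_smul]
  · intro τ hτ
    have hcθ : ‖c τ - θ₁‖ ≤ ‖θ₂ - θ₁‖ := by
      have : c τ - θ₁ = τ • (θ₂ - θ₁) := by simp [hc]
      rw [this, norm_smul, Real.norm_eq_abs, abs_of_nonneg hτ.1]
      exact mul_le_of_le_one_left (norm_nonneg _) hτ.2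
    have hnc : |1 - ‖c τ‖| ≤ ‖θ₂ - θ₁‖ := by
      have := abs_norm_sub_norm_le θ₁ (c τ)
      rw [h₁] at this
      exact this.trans (by rw [norm_sub_rev]; exact hcθ)
    have hγc : ‖(1 / ‖c τ‖) • c τ - c τ‖ = |1 - ‖c τ‖| := by
      have hn0 : ‖c τ‖ ≠ 0 := norm_ne_zero_iff.2 (hc0 τ)
      rw [show (1 / ‖c τ‖) • c τ - c τ = (1 / ‖c τ‖ - 1) • c τ by rw [sub_smul, one_smul], norm_smul,
        Real.norm_eq_abs]
      rw [show (1 / ‖c τ‖ - 1) = (1 - ‖c τ‖) / ‖c τ‖ by field_simp, abs_div, abs_norm, div_mul_cancel₀ _ hn0]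
    calc ‖(1 / ‖c τ‖) • c τ - θ₁‖ ≤ ‖(1 / ‖c τ‖) • c τ - c τ‖ + ‖c τ - θ₁‖ := norm_sub_le_norm_sub_add_norm_sub _ _ _
      _ ≤ ‖θ₂ - θ₁‖ + ‖θ₂ - θ₁‖ := by rw [hγc]; exact add_le_add hnc hcθ
      _ = 2 * ‖θ₂ - θ₁‖ := by ring

end Summit.NavierStokesRegularity.NavierStokesRegularity.Theorems.PoloidalLiouville.Antidynamo

end
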